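import Literature.Geometry.Lorentzian.KillingChartJetRigidity
import Literature.Geometry.Lorentzian.KerrKillingTangency
import HarnessLib

/-!
# Killing fields of a chart metric are determined by their 1-jet at a point (manifold form)

Repackaging of the chart-level one-jet rigidity of `KillingChartJetRigidity.lean`
(`KillingJetRigidity.eqOn_zero_of_isPreconnected`: a `C²` solution of the coordinate Killing equation
with vanishing 1-jet at one point of a preconnected open set vanishes) for the tree's Killing fields
(`PseudoRiemannianMetric.IsKillingField`) of a `C^∞` pseudo-Riemannian metric on an open submanifold
`U : Opens E` of a finite-dimensional real normed space — the setting of every concrete metric of the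
library (Minkowski, Schwarzschild, Kerr, …; `OpensChart`):

* `OpensChart.IsKillingField.killingEq_coord` — the coordinate Killing equation
  `DG(Xf)(·,·) + G(DXf ·,·) + G(·, DXf ·) = 0` for representatives `G`, `Xf` of the metric and the field
  (O'Neill 1983, Ch. 9, Prop. 9.25; the Kerr instance is `Kerr.killing_coord_lie_eq_zero`);
* `OpensChart.IsKillingField.fderiv_coordRepr_eq_zero_of_leviCivita_eq_zero` — at a zero of `X`,
  `∇X(x₀) = 0` iff `DXf(x₀) = 0` (`∇_v X = DXf v + Γ(X x₀) v`);
* **`OpensChart.IsKillingField.eq_zero_of_oneJet_eq_zero`** — on a preconnected `U`, a Killing field with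
  `X x₀ = 0` and `∇X(x₀) = 0` vanishes identically. O'Neill 1983, Ch. 9, Lemma 9.28; Kobayashi–Nomizu I,
  Ch. VI, Thm. 3.3. Unlike the tree's `IsKillingField.eq_zero_of_oneJet_eq_zero`
  (`KillingAlgebraAsymptoticallyFlatProofs.lean`), NO completeness of `X` is required.

Everything is proved; no definitions, no named facts.

## References

* B. O'Neill, *Semi-Riemannian geometry with applications to relativity*, Academic Press 1983, Ch. 9,
  Prop. 9.25, Lemma 9.28. [ONeill1983]
* S. Kobayashi, K. Nomizu, *Foundations of Differential Geometry* I, Wiley 1963, Ch. VI, Thm. 3.3.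
-/

noncomputable section

set_option maxSynthPendingDepth 3

open Set Filter Function TopologicalSpace
open scoped Manifold ContDiff Topology

namespace Literature.Geometry.Lorentzian

namespace OpensChart

variable {E : Type*} [NormedAddCommGroup E] [NormedSpace ℝ E] [FiniteDimensional ℝ E]
  {U : Opens E} {g : PseudoRiemannianMetric 𝓘(ℝ, E) ∞ E (TangentSpace 𝓘(ℝ, E) : U → Type _)}
  [g.HasLeviCivita] {X : Π y : U, TangentSpace 𝓘(ℝ, E) y}

/-- **The coordinate Killing equation of a chart metric.** For a Killing field `X` of a `C^∞` metric `g`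
on `U : Opens E` with representatives `G` (`g.val y = G y`) and `Xf` (`X y = Xf y`):
`DG_x(Xf x)(v, w) + G_x(DXf_x v, w) + G_x(v, DXf_x w) = 0` at every `x ∈ U`. O'Neill 1983, Ch. 9,
Prop. 9.25 (Killing ⇔ `𝓛_X g = 0`), read in coordinates. [cite: ONeill1983, Ch. 9, Prop. 9.25] -/
theorem _root_.Literature.Geometry.Lorentzian.PseudoRiemannianMetric.IsKillingField.killingEq_coord
    (hX : g.IsKillingField X) {G : E → E →L[ℝ] E →L[ℝ] ℝ} (hG : ∀ y : U, g.val y = G y)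
    {Xf : E → E} (hXf : ∀ y : U, X y = Xf y) (x : U) (v w : E) :
    fderiv ℝ G x (Xf x) v w + G x (fderiv ℝ Xf x v) w + G x v (fderiv ℝ Xf x w) = 0 := by
  have hXd : DifferentiableAt ℝ Xf x := (hX.contDiffAt_coordRepr hXf x).differentiableAt (by simp)
  have hlc : ∀ W : E, g.leviCivita X x W = fderiv ℝ Xf x W + christoffel g G x (Xf x) W := by
    intro W
    rw [leviCivita_apply_eq hG x hXf hXd W, hXf x]
  refine killing_coord_of_christoffel hG x (differentiableAt_repr hG x) (Xf x) (fderiv ℝ Xf x)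
    (fun v w ↦ ?_) v w
  have hK := hX.val_leviCivita_add x v w
  rw [hlc v, hlc w, hG x] at hK
  exact hK

/-- **At a zero of a Killing field, `∇X(x₀) = 0` forces `DXf(x₀) = 0`** for any differentiable
representative (`∇_v X(x₀) = DXf_{x₀} v + Γ_{x₀}(X x₀) v` and `Γ(0) = 0`). [folklore] -/
theorem _root_.Literature.Geometry.Lorentzian.PseudoRiemannianMetric.IsKillingField.fderiv_coordRepr_eq_zero_of_leviCivita_eq_zero
    (hX : g.IsKillingField X) {G : E → E →L[ℝ] E →L[ℝ] ℝ} (hG : ∀ y : U, g.val y = G y)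
    {Xf : E → E} (hXf : ∀ y : U, X y = Xf y) {x₀ : U} (h0 : X x₀ = 0)
    (h1 : ∀ v : E, g.leviCivita X x₀ v = 0) : fderiv ℝ Xf x₀ = 0 := by
  have hXd : DifferentiableAt ℝ Xf x₀ := (hX.contDiffAt_coordRepr hXf x₀).differentiableAt (by simp)
  ext v
  have h := h1 v
  rw [leviCivita_apply_eq hG x₀ hXf hXd v, h0] at h
  have hΓ : christoffel g G x₀ (0 : E) v = 0 := by
    have := christoffel_smul (g := g) (G := G) x₀ 0 (0 : E) v
    rw [zero_smul, zero_smul] at this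
    exact this
  have h' : fderiv ℝ Xf x₀ v + christoffel g G x₀ (0 : E) v = 0 := h
  rw [hΓ, add_zero] at h'
  rw [h']
  rfl

/-- **One-jet rigidity of Killing fields on a preconnected chart (no completeness).** A Killing field of
a `C^∞` metric on a preconnected `U : Opens E` with `X x₀ = 0` and `∇X(x₀) = 0` at one point vanishes
identically: its coordinate representative solves the coordinate Killing equation
(`IsKillingField.killingEq_coord`) with vanishing 1-jet at `x₀`, so
`KillingJetRigidity.eqOn_zero_of_isPreconnected` applies. O'Neill 1983, Ch. 9, Lemma 9.28;
Kobayashi–Nomizu I, Ch. VI, Thm. 3.3. [cite: ONeill1983, Ch. 9, Lemma 9.28] -/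
theorem _root_.Literature.Geometry.Lorentzian.PseudoRiemannianMetric.IsKillingField.eq_zero_of_oneJet_eq_zero'
    (hU : IsPreconnected (U : Set E)) (hX : g.IsKillingField X) {x₀ : U} (h0 : X x₀ = 0)
    (h1 : ∀ v : E, g.leviCivita X x₀ v = 0) : ∀ y : U, X y = 0 := by
  classical
  -- representatives of the metric and of the field
  set G : E → E →L[ℝ] E →L[ℝ] ℝ := fun y ↦ if h : y ∈ U then g.val ⟨y, h⟩ else 0 with hG_def
  have hG : ∀ y : U, g.val y = G y := fun y ↦ by simp [hG_def, y.2]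
  set Xf : E → E := fun y ↦ if h : y ∈ U then (X ⟨y, h⟩ : E) else 0 with hXf_def
  have hXf : ∀ y : U, X y = Xf y := fun y ↦ by simp [hXf_def, y.2]
  have hUo : IsOpen (U : Set E) := U.isOpen
  have hG2 : ContDiffOn ℝ 2 G U := fun y hy ↦
    ((contDiffAt_repr hG ⟨y, hy⟩).of_le ENat.LEInfty.out).contDiffWithinAt
  have hX2 : ContDiffOn ℝ 2 Xf U := fun y hy ↦
    ((hX.contDiffAt_coordRepr hXf ⟨y, hy⟩).of_le ENat.LEInfty.out).contDiffWithinAt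
  have hsymm : ∀ y ∈ (U : Set E), ∀ u w : E, G y u w = G y w u := fun y hy u w ↦ by
    rw [← hG ⟨y, hy⟩]; exact g.symm ⟨y, hy⟩ u w
  have hnd : ∀ y ∈ (U : Set E), ∀ u : E, (∀ w, G y u w = 0) → u = 0 := fun y hy u hu ↦
    g.nondegenerate ⟨y, hy⟩ u fun w ↦ by rw [hG ⟨y, hy⟩]; exact hu w
  have hK : ∀ y ∈ (U : Set E), ∀ v w : E,
      fderiv ℝ G y (Xf y) v w + G y (fderiv ℝ Xf y v) w + G y v (fderiv ℝ Xf y w) = 0 :=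
    fun y hy v w ↦ hX.killingEq_coord hG hXf ⟨y, hy⟩ v w
  have hz0 : Xf x₀ = 0 := by rw [← hXf x₀, h0]; rfl
  have hz1 : fderiv ℝ Xf x₀ = 0 := hX.fderiv_coordRepr_eq_zero_of_leviCivita_eq_zero hG hXf h0 h1
  have h := KillingJetRigidity.eqOn_zero_of_isPreconnected hUo hU hG2 hX2 hsymm hnd hK x₀.2 hz0 hz1
  intro y
  rw [hXf y]
  exact (h y y.2).1

end OpensChart

end Literature.Geometry.Lorentzian

end
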